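import Mathlib
import HarnessLib
import Literature.Analysis.FluidPDE.SelfSimilar
import Literature.Analysis.FluidPDE.AxisymmetricEuler
import Literature.Analysis.FluidPDE.AxisymmetricVorticityTransport
import Literature.Analysis.FluidPDE.PineauVicolRSS
import Summits.NavierStokesRegularity.NavierStokesRegularity.Theorems.DssFarFieldSlavingBlowupTypeIDssProfileRotatingMirror
import Summits.NavierStokesRegularity.NavierStokesRegularity.Theorems.DssFarFieldSlavingBlowupTypeIDssProfileMirrorCorotating
import Summits.NavierStokesRegularity.NavierStokesRegularity.Theorems.DssFarFieldSlavingBlowupTypeIDssProfileRigidRotation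
import Summits.NavierStokesRegularity.NavierStokesRegularity.Theorems.DssFarFieldSlavingBlowupTypeIDssProfileLargeOrderLiouville
import Summits.NavierStokesRegularity.NavierStokesRegularity.Theorems.DssFarFieldSlavingBlowupTypeIDssProfilePineauVicolClass

/-!
# Blow-up scenario census, blocks R / A — the rows whose closers sit in the `DssFarFieldSlaving` cone

Cell `pub/ns-census` (director-ns KEY req102, D-0154 (A), 2026-08-28), typer seat `ns-census-typer-2`.
Companion of `ScenarioCensusRotating.lean` (block R) and `ScenarioCensusAncient.lean` /
`ScenarioCensusAncientSymmetry.lean` (block A) for the four cells of `SCENARIO-CENSUS.md` (v1.8–v1.10)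
that are EXCLUDED-IN-TREE by theorems living in modules of route `DssFarFieldSlaving`'s Theorems family
(`…TypeIDssProfileRotatingMirror`, `…MirrorCorotating`, `…RigidRotation`, `…LargeOrderLiouville`).
Those modules import the route's Theses file, so any census file importing them is rebuilt on every
edit of that route (`lint.theses-cone`); they are therefore indexed HERE, in a file of their own, and
the cone-free census files stay appendable (same device as typer-1's `ScenarioCensusForwardF1a.lean`).

## What a row is

`Row_<key> : Prop` restates VERBATIM (binders made explicit) the statement of the closing tree theorem;
`theorem row_<key>_excluded : Row_<key>` is that theorem by name. All four cells concern the
Type-I ancient / rotated-self-similar profile classes of the census (ancient mild `ν = 1`, measurable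
slices, envelope `HasTypeIDecay M u : ‖u(t,x)‖ ≤ M/(‖x‖+√(−t))`; Pineau–Vicol ansatz `pvAnsatz α W`
for rotating profiles; `IsRotatedDSS c R u`; rotations `rotZ`, `rotZLIE` about `e₃`).

| key | cell | closing theorem | value |
|---|---|---|---|
| R6b | RSS `pvAnsatz α W`, `α ≠ 0`, time-dependent profile `W(·,s)` continuous and equivariant under a rotation-REVERSING isometry `g` (`g R_φ = R_{−φ} g`: "co-rotating mirror") | `Theorems.RotatingMirror.rdssClass_corotatingMirror_empty` | EXCLUDED-IN-TREE |
| R6c | RSS `pvAnsatz α U`, `α ≠ 0`, stationary continuous profile `U` equivariant under such a `g` ("mirror co-rotating") | `Theorems.ReversingIsotropy.rdssClass_mirrorCorotating_empty` | EXCLUDED-IN-TREE |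
| R6d | RDSS member, rotated self-similar about a TILTED axis `P e₃` (`α ≠ 0`), one slice a.e. equivariant under an isometry `g` NOT commuting with some rotation about that axis ("tilted rigid rotation") — no non-trivial member | `Theorems.RigidRotation.rdssClass_tiltedRigidRotation_empty` | EXCLUDED-IN-TREE |
| A9′ (`Row_A9p`) | Type I (space–time envelope, constant `C₀`) · `m`-fold rotational symmetry about `e₃` of every slice, `m ≥ m₀(C₀)` (LARGE order) · classical on `(−∞,0)`, `ν = 1`: `u ≡ 0` — NO self-similarity | `Theorems.LargeOrderLiouville.largeOrderTypeILiouville` | EXCLUDED-IN-TREE |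
| A9′ mild form (`Row_A9pMild`) | same in the ancient-mild class with a.e.-equivariant slices: slices a.e. `0` | `Theorems.LargeOrderLiouville.typeI_ancient_mFold_ae_zero` | EXCLUDED-IN-TREE |

Plus the RSS corollary of A9′ (`row_A9p_rss` = `…largeOrderRssLiouville`: an `m`-fold symmetric `C²`
RSS profile of any twist at Type-I constant `C₀` vanishes once `m ≥ m₀(C₀)`). The order threshold
`m₀` depends on the Type-I constant: FIXED small groups (census F13 / A9, open) are not covered.
No summit statement is proved or claimed here; nothing in this file is a claim about Navier–Stokes
regularity.
-/

noncomputable section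

set_option linter.dupNamespace false

open MeasureTheory Set Filter Topology
open scoped ENNReal NNReal

namespace Summit.NavierStokesRegularity.NavierStokesRegularity.Theorems.ScenarioCensus

open Literature.Analysis

/-- Census row R6b — (Type I · rotated self-similar in the Pineau–Vicol ansatz `u = pvAnsatz α W` with
angular speed `α ≠ 0` and a time-dependent profile `W(y, s)` with continuous slices, each equivariant
under one rotation-REVERSING linear isometry `g` (`g ∘ R_φ = R_{−φ} ∘ g`; "co-rotating mirror") ·
ancient mild `ν = 1`, measurable slices, envelope `HasTypeIDecay M`): `W = 0`. Restated verbatim from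
`Theorems.RotatingMirror.rdssClass_corotatingMirror_empty` (route DssFarFieldSlaving, T22′).
Value: EXCLUDED-IN-TREE. -/
def Row_R6b : Prop :=
  ∀ (M α : ℝ), α ≠ 0 →
    ∀ (g : EuclideanSpace ℝ (Fin 3) ≃ₗᵢ[ℝ] EuclideanSpace ℝ (Fin 3)),
      (∀ (φ : ℝ) (y : EuclideanSpace ℝ (Fin 3)), g (FluidPDE.rotZ φ y) = FluidPDE.rotZ (-φ) (g y)) →
      ∀ (W : EuclideanSpace ℝ (Fin 3) → ℝ → EuclideanSpace ℝ (Fin 3)),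
        (∀ s : ℝ, Continuous fun y => W y s) → (∀ y s, W (g y) s = g (W y s)) →
        ∀ (u : ℝ → EuclideanSpace ℝ (Fin 3) → EuclideanSpace ℝ (Fin 3)),
          FluidPDE.IsAncientMildSolution 1 u → (∀ t < 0, AEStronglyMeasurable (u t) volume) →
          FluidPDE.HasTypeIDecay M u → (∀ t < 0, ∀ x, u t x = FluidPDE.pvAnsatz α W t x) → W = 0

/-- R6b is EXCLUDED-IN-TREE: `Theorems.RotatingMirror.rdssClass_corotatingMirror_empty`. -/
theorem row_R6b_excluded : Row_R6b :=
  fun _ _ hα _ hg _ hW hGW _ hmild hmeas hdec hans =>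
    RotatingMirror.rdssClass_corotatingMirror_empty hα hg hW hGW hmild hmeas hdec hans

/-- Census row R6c — (Type I · rotated self-similar `u = pvAnsatz α U` with `α ≠ 0` and a STATIONARY
continuous profile `U` equivariant under a rotation-reversing linear isometry `g` ("mirror
co-rotating") · ancient mild `ν = 1`, measurable slices, envelope `HasTypeIDecay M`): `U = 0`.
Restated verbatim from `Theorems.ReversingIsotropy.rdssClass_mirrorCorotating_empty` (T22).
Value: EXCLUDED-IN-TREE. -/
def Row_R6c : Prop :=
  ∀ (M α : ℝ), α ≠ 0 →
    ∀ (g : EuclideanSpace ℝ (Fin 3) ≃ₗᵢ[ℝ] EuclideanSpace ℝ (Fin 3)),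
      (∀ (φ : ℝ) (y : EuclideanSpace ℝ (Fin 3)), g (FluidPDE.rotZ φ y) = FluidPDE.rotZ (-φ) (g y)) →
      ∀ (U : EuclideanSpace ℝ (Fin 3) → EuclideanSpace ℝ (Fin 3)), Continuous U →
        (∀ y, U (g y) = g (U y)) →
        ∀ (u : ℝ → EuclideanSpace ℝ (Fin 3) → EuclideanSpace ℝ (Fin 3)),
          FluidPDE.IsAncientMildSolution 1 u → (∀ t < 0, AEStronglyMeasurable (u t) volume) →
          FluidPDE.HasTypeIDecay M u →
          (∀ t < 0, ∀ x, u t x = FluidPDE.pvAnsatz α (fun y _ => U y) t x) → U = 0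

/-- R6c is EXCLUDED-IN-TREE: `Theorems.ReversingIsotropy.rdssClass_mirrorCorotating_empty`. -/
theorem row_R6c_excluded : Row_R6c :=
  fun _ _ hα _ hg _ hU hGU _ hmild hmeas hdec hans =>
    ReversingIsotropy.rdssClass_mirrorCorotating_empty hα hg hU hGU hmild hmeas hdec hans

/-- Census row R6d — (Type I · RDSS member of the census class (`IsRotatedDSS c R u`, `c > 1`,
ancient mild `ν = 1`, measurable slices, envelope `HasTypeIDecay M`) which is moreover rotated
self-similar with angular speed `α ≠ 0` about the TILTED axis `P e₃` (a.e. on every slice, all scaling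
factors `λ > 0`) and whose slice `u(−1)` is a.e. equivariant under a linear isometry `g` that does NOT
commute with some rotation about that axis ("tilted rigid rotation")): no such member is
non-trivial. Restated verbatim from `Theorems.RigidRotation.rdssClass_tiltedRigidRotation_empty`.
Value: EXCLUDED-IN-TREE. -/
def Row_R6d : Prop :=
  ∀ (M α : ℝ), α ≠ 0 →
    ∀ (P g : EuclideanSpace ℝ (Fin 3) ≃ₗᵢ[ℝ] EuclideanSpace ℝ (Fin 3)),
      (∃ (φ : ℝ) (y : EuclideanSpace ℝ (Fin 3)),
          g (((P.symm.trans (FluidPDE.rotZLIE φ)).trans P) y) ≠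
            ((P.symm.trans (FluidPDE.rotZLIE φ)).trans P) (g y)) →
      ¬ ∃ (c : ℝ) (R : EuclideanSpace ℝ (Fin 3) ≃ₗᵢ[ℝ] EuclideanSpace ℝ (Fin 3))
          (u : ℝ → EuclideanSpace ℝ (Fin 3) → EuclideanSpace ℝ (Fin 3)),
        1 < c ∧ FluidPDE.IsAncientMildSolution 1 u ∧ (∀ t < 0, AEStronglyMeasurable (u t) volume) ∧
        FluidPDE.IsRotatedDSS c R u ∧ FluidPDE.HasTypeIDecay M u ∧
        (∀ lam : ℝ, 0 < lam → ∀ t < 0,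
          (fun x => lam • ((P.symm.trans (FluidPDE.rotZLIE (-(α * (2 * Real.log lam))))).trans P).symm
            (u (lam ^ 2 * t)
              (lam • ((P.symm.trans (FluidPDE.rotZLIE (-(α * (2 * Real.log lam))))).trans P) x)))
            =ᵐ[volume] u t) ∧
        ((fun x => u (-1) (g x)) =ᵐ[volume] fun x => g (u (-1) x)) ∧
        ¬ (∀ t < 0, u t =ᵐ[volume] 0)

/-- R6d is EXCLUDED-IN-TREE: `Theorems.RigidRotation.rdssClass_tiltedRigidRotation_empty`. -/
theorem row_R6d_excluded : Row_R6d :=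
  fun M _ hα P _ hg => RigidRotation.rdssClass_tiltedRigidRotation_empty M hα P hg

/-- Census row A9′ (Lean name `Row_A9p`) — (Type I, space–time envelope `‖u(t,x)‖ ≤ C₀/(‖x‖+√(−t))`
· `m`-FOLD rotational symmetry of every slice about the fixed axis `e₃`, `u(t, R_{2π/m} x) =
R_{2π/m} u(t,x)`, with `m ≥ m₀(C₀)` (LARGE order only; `m₀` ineffective) · classical solution on
`(−∞, 0)`, `ν = 1`, no force): `u ≡ 0` — NO self-similarity assumed. Restated verbatim from
`Theorems.LargeOrderLiouville.largeOrderTypeILiouville` (compactness + KNSS 2009 Thm 5.3). The tree's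
only finite-symmetry-group exclusion; fixed small groups (F13 / A9) are NOT covered.
Value: EXCLUDED-IN-TREE. -/
def Row_A9p : Prop :=
  ∀ C₀ : ℝ, 0 < C₀ → ∃ m₀ : ℕ, ∀ m : ℕ, m₀ ≤ m →
    ∀ (u : ℝ → EuclideanSpace ℝ (Fin 3) → EuclideanSpace ℝ (Fin 3))
      (p : ℝ → EuclideanSpace ℝ (Fin 3) → ℝ),
      FluidPDE.IsClassicalNSSolutionOn (Set.Iio 0) 1 0 u p → FluidPDE.HasTypeIDecay C₀ u →
      (∀ t < 0, ∀ x : EuclideanSpace ℝ (Fin 3),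
          u t (FluidPDE.rotZ (2 * Real.pi / m) x) = FluidPDE.rotZ (2 * Real.pi / m) (u t x)) →
        ∀ t < 0, ∀ x, u t x = 0

/-- A9′ is EXCLUDED-IN-TREE: `Theorems.LargeOrderLiouville.largeOrderTypeILiouville`. -/
theorem row_A9p_excluded : Row_A9p :=
  LargeOrderLiouville.largeOrderTypeILiouville

/-- Census row A9′, ancient-MILD form (Lean name `Row_A9pMild`) — (Type I envelope with constant `M`
· slices a.e. equivariant under `R_{2π/m}`, `m ≥ m₀(M)` · ancient mild `ν = 1`, measurable slices):
every slice is a.e. `0`. Restated verbatim from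
`Theorems.LargeOrderLiouville.typeI_ancient_mFold_ae_zero` (class level of A9′ through the classical
representative). Value: EXCLUDED-IN-TREE. -/
def Row_A9pMild : Prop :=
  ∀ M : ℝ, 0 < M → ∃ m₀ : ℕ, ∀ m : ℕ, m₀ ≤ m →
    ∀ (u : ℝ → EuclideanSpace ℝ (Fin 3) → EuclideanSpace ℝ (Fin 3)),
      FluidPDE.IsAncientMildSolution 1 u → (∀ t < 0, AEStronglyMeasurable (u t) volume) →
      FluidPDE.HasTypeIDecay M u →
      (∀ t < 0, (fun x => u t (FluidPDE.rotZ (2 * Real.pi / m) x)) =ᵐ[volume]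
          fun x => FluidPDE.rotZ (2 * Real.pi / m) (u t x)) →
        ∀ t < 0, u t =ᵐ[volume] 0

/-- The mild form of A9′ is EXCLUDED-IN-TREE: `Theorems.LargeOrderLiouville.typeI_ancient_mFold_ae_zero`. -/
theorem row_A9pMild_excluded : Row_A9pMild :=
  LargeOrderLiouville.typeI_ancient_mFold_ae_zero

/-- The RSS corollary of A9′ (census A9′ row, third decl; block R side): for every `C₀ > 0` there is
`m₀` such that an `m`-fold symmetric `C²` profile `U` of a rotated self-similar field `pvAnsatz α U`
(ANY twist `α`), classical on `[−1,0)` with envelope `C₀/(‖x‖+√(−t))`, vanishes once `m ≥ m₀` — BY NAME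
`Theorems.LargeOrderLiouville.largeOrderRssLiouville`. -/
theorem row_A9p_rss :
    ∀ C₀ : ℝ, 0 < C₀ → ∃ m₀ : ℕ, ∀ m : ℕ, m₀ ≤ m →
      ∀ (α : ℝ) (u : ℝ → EuclideanSpace ℝ (Fin 3) → EuclideanSpace ℝ (Fin 3))
        (p : ℝ → EuclideanSpace ℝ (Fin 3) → ℝ) (U : EuclideanSpace ℝ (Fin 3) → EuclideanSpace ℝ (Fin 3)),
        FluidPDE.IsClassicalNSSolutionOn (Set.Ico (-1) 0) 1 0 u p →
        (∀ t ∈ Set.Ico (-1 : ℝ) 0, ∀ x : EuclideanSpace ℝ (Fin 3),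
            ‖u t x‖ ≤ C₀ / (‖x‖ + Real.sqrt (-t))) →
        ContDiff ℝ 2 U →
        (∀ y, U (FluidPDE.rotZ (2 * Real.pi / m) y) = FluidPDE.rotZ (2 * Real.pi / m) (U y)) →
        (∀ t ∈ Set.Ico (-1 : ℝ) 0, ∀ x : EuclideanSpace ℝ (Fin 3),
            u t x = FluidPDE.pvAnsatz α (fun y _ => U y) t x) → U = 0 :=
  LargeOrderLiouville.largeOrderRssLiouville

/-- R5 ⊂ A9′ bookkeeping: the census row R8 / `Row_R8` (helical RSS stratum) and R5 (axisymmetric =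
`m`-fold for every `m`) are the extreme cases; here we only record that the mild form gives the
rotated-DSS sub-cell of D7c verbatim (`Theorems.LargeOrderLiouville.rdssClass_mFold_ae_zero`: the
self-similarity is carried, not used). -/
theorem row_A9pMild_rdss (h : Row_A9pMild) :
    ∀ M : ℝ, 0 < M → ∃ m₀ : ℕ, ∀ m : ℕ, m₀ ≤ m →
      ∀ (c : ℝ) (R : EuclideanSpace ℝ (Fin 3) ≃ₗᵢ[ℝ] EuclideanSpace ℝ (Fin 3))
        (u : ℝ → EuclideanSpace ℝ (Fin 3) → EuclideanSpace ℝ (Fin 3)),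
        1 < c → FluidPDE.IsAncientMildSolution 1 u → (∀ t < 0, AEStronglyMeasurable (u t) volume) →
        FluidPDE.IsRotatedDSS c R u → FluidPDE.HasTypeIDecay M u →
        (∀ t < 0, (fun x => u t (FluidPDE.rotZ (2 * Real.pi / m) x)) =ᵐ[volume]
            fun x => FluidPDE.rotZ (2 * Real.pi / m) (u t x)) →
          ∀ t < 0, u t =ᵐ[volume] 0 := by
  intro M hM
  obtain ⟨m₀, hm₀⟩ := h M hM
  exact ⟨m₀, fun m hm c R u _ hu hmeas _ hdec hG => hm₀ m hm u hu hmeas hdec hG⟩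

/-! ## Appendix 1 (append-only round 2): CLASS-level twins of R1 / R3 (Pineau–Vicol regimes)

Census rows R1 / R3 are EXCLUDED-IN-TREE by the Literature facts `pineauVicol2026_rss_liouville` /
`pineauVicol2026_rdss_liouville` (`Row_R1`, `Row_R3` of `ScenarioCensusRotating.lean`, classical
Pineau–Vicol class); the census (v1.8, ref H3) also cites their transports to the census CLASS
(ancient mild `ν = 1`, measurable slices, Type-I envelope `M`) — `Theorems.rdssClass_pineauVicol_rss`,
`…_slow`, `…_fast` of `…TypeIDssProfilePineauVicolClass` (cone of routes DssFarFieldSlaving /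
RellichScar) —, typed here by the same device as above. -/

/-- Census row R1, CLASS-level form (Lean name `Row_R1c`) — (Type I envelope with constant `M` ·
rotated SELF-similar: pointwise on `t < 0` the Pineau–Vicol ansatz `pvAnsatz α U` of a CONTINUOUS
stationary profile `U`, angular speed `|α| < α₁(M)` or `|α| > α₂(M)` · ancient mild `ν = 1`,
measurable slices): `U = 0` (Pineau–Vicol 2026 Thm 1.4 transported to the census class through the
classical representative; thresholds ineffective). Restated verbatim from
`Theorems.rdssClass_pineauVicol_rss`. Value: EXCLUDED-IN-TREE (the class-level twin of `Row_R1`). -/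
def Row_R1c : Prop :=
  ∀ M : ℝ, 0 < M → ∃ α₁ α₂ : ℝ, 0 < α₁ ∧ 0 < α₂ ∧
    ∀ (α : ℝ) (u : ℝ → EuclideanSpace ℝ (Fin 3) → EuclideanSpace ℝ (Fin 3))
      (U : EuclideanSpace ℝ (Fin 3) → EuclideanSpace ℝ (Fin 3)),
      FluidPDE.IsAncientMildSolution 1 u → (∀ t < 0, AEStronglyMeasurable (u t) volume) →
      FluidPDE.HasTypeIDecay M u → Continuous U →
      (∀ t < 0, ∀ x, u t x = FluidPDE.pvAnsatz α (fun y _ => U y) t x) →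
      (|α| < α₁ ∨ α₂ < |α|) → U = 0

/-- R1c is EXCLUDED-IN-TREE: `Theorems.rdssClass_pineauVicol_rss`. -/
theorem row_R1c_excluded : Row_R1c :=
  fun _ hM => rdssClass_pineauVicol_rss hM

/-- Census row R3, CLASS-level form (Lean name `Row_R3c`) — (Type I envelope with constant `M` ·
rotated `c`-DSS with twist `R_{−θ}` about `e₃` (`IsRotatedDSS c (rotZLIE (−θ)) u`), in either
Pineau–Vicol regime: (i) SLOW `|θ/(2 log c)| ≤ α₁(M)` and `1 < c < c₁(M)`, or (ii) FAST
`|θ/(2 log c)| ≥ α₂(M)` and `c < c₂(M)^{1/(1+(θ/(2 log c))²)}` · ancient mild `ν = 1`, measurable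
slices): every slice is a.e. `0` (Pineau–Vicol 2026 Thm 1.7 (i)/(ii) transported to the census class;
thresholds ineffective). The conjunction of `Theorems.rdssClass_pineauVicol_slow` and
`Theorems.rdssClass_pineauVicol_fast`, restated verbatim. Value: EXCLUDED-IN-TREE (class-level twin
of `Row_R3`). -/
def Row_R3c : Prop :=
  (∀ M : ℝ, 0 < M → ∃ α₁ c₁ : ℝ, 0 < α₁ ∧ 1 < c₁ ∧
    ∀ (c θ : ℝ) (u : ℝ → EuclideanSpace ℝ (Fin 3) → EuclideanSpace ℝ (Fin 3)),
      1 < c → c < c₁ → |θ / (2 * Real.log c)| ≤ α₁ →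
      FluidPDE.IsAncientMildSolution 1 u → (∀ t < 0, AEStronglyMeasurable (u t) volume) →
      FluidPDE.IsRotatedDSS c (FluidPDE.rotZLIE (-θ)) u → FluidPDE.HasTypeIDecay M u →
        ∀ t < 0, u t =ᵐ[volume] 0) ∧
  (∀ M : ℝ, 0 < M → ∃ α₂ c₂ : ℝ, 0 < α₂ ∧ 1 < c₂ ∧
    ∀ (c θ : ℝ) (u : ℝ → EuclideanSpace ℝ (Fin 3) → EuclideanSpace ℝ (Fin 3)),
      1 < c → α₂ ≤ |θ / (2 * Real.log c)| →
      c < c₂ ^ (1 / (1 + (θ / (2 * Real.log c)) ^ 2)) →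
      FluidPDE.IsAncientMildSolution 1 u → (∀ t < 0, AEStronglyMeasurable (u t) volume) →
      FluidPDE.IsRotatedDSS c (FluidPDE.rotZLIE (-θ)) u → FluidPDE.HasTypeIDecay M u →
        ∀ t < 0, u t =ᵐ[volume] 0)

/-- R3c is EXCLUDED-IN-TREE: `Theorems.rdssClass_pineauVicol_slow` and `…_fast`. -/
theorem row_R3c_excluded : Row_R3c :=
  ⟨fun _ hM => rdssClass_pineauVicol_slow hM, fun _ hM => rdssClass_pineauVicol_fast hM⟩

end Summit.NavierStokesRegularity.NavierStokesRegularity.Theorems.ScenarioCensus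

end
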